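/-
Copyright: statement-level skeleton of a published paper (lit-balaban cell, Phase-2 proof seat p20 gen 6). No proof claims
beyond what the kernel checks below.
-/
import Literature.MathematicalPhysics.QuantumFieldTheory.Balaban1983to89.B3Bound316ZeroTorus
import Literature.MathematicalPhysics.QuantumFieldTheory.Balaban1983to89.B3Sect3EstimatesZeroTorus
import Literature.MathematicalPhysics.QuantumFieldTheory.Balaban1983to89.B3Resummation315

/-!
# B3 — T. Bałaban, *(Higgs)₂,₃ quantum fields in a finite volume. III. Renormalization*, CMP **88** (1983) 411–445
[Balaban1983Higgs3], p. 437 [PDF 27], **(3.17)**: *"Thus we have finished the analysis of (3.8) and we can summarize it in the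
following graphical form [(3.8) summed = Σ (generalized graph (3.12)) + (local vertex)] (3.17) It is of the required form (3.5)."* —
the END-TO-END content of (3.17) PROVED at the zero-field TORUS MODEL INSTANCE (`d = 3`, `A = B̃ = 0`, `Ω = T_η`, Bałaban's scalar
torus tower): the sum over the indices `j, j′ < j″` of the expressions (3.9) of the graph (3.8) EQUALS the local vertex (3.15) — whose
coefficient is BOUNDED uniformly in the volume and the scale — minus the sum of the generalized expressions (3.12), each obeying the
generalized-graph estimate (3.13); together with the p. 437 RESCALING SENTENCE *"Rescaling it from the η-lattice to the L^{−j″}-lattice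
(x, x′ = L^{j″}ηy, L^{j″}ηy′, y, y′ ∈ T_{L^{−j″}}) we get the same expression but with L^{−j″} instead of η"* PROVED as an identity for
the square bracket of (3.15)

statement-level skeleton of published theorems with citation tags; proofs where landed; nothing here is a claim about
the Yang–Mills mass gap

PDF held: `paper:balaban1983-higgs-2-3-quantum-fields-finite-volume` (journal page = PDF page + 410); pp. 435–437 [PDF 25–27] read in
the OCR text (`p0025.txt`–`p0027.txt`).  Row **B3.Eq3.11-3.17** of `HOME/lit-balaban-r15/ROWS-B3.md` (fold owner r15, referee ref-4),
sub-display (3.17) and the two p. 437 sentences quoted above (the row records *"(3.17) picture … not typed"*; the picture itself is p18's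
lane — what is proved here is its CONTENT as an identity with estimates).  CONSUMES BY NAME, nothing re-proved: r15's
`B3Sect3ScalarSelfEnergy` ((3.9) `expr39`, `coeff39`, `dKernel`; (3.15) `bracket315`/`expr315`), p20 g2's `B3Taylor310Remainder`
(`disp`, `eq311_taylor`) and `B3Ineq313Pointwise` ((3.12) `term312`, `eq311_split`), p20 g4's `B3Resummation315.expr315_sum_sum`
(multilinearity = the summation over orderings and indices), p20 g5's `B3Sect3KernelsZeroTorus` (`gpiece` = the scale pieces
`G^η_{(j)}` of the zero-field torus tower as Sect.-3 kernels, `abs_term312_le_zeroTorus` = (3.13) with the kernel hypotheses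
discharged), p03 g4's `B3Ineq210ZeroTorus.sum_pieceT` ((2.6) for the tower), p39 g6's `B3GkZeroTorusRescaled` (`G0xi` = the rescaled
propagator `G^ξ_{j″}(0)`, `G0xi_eq_sum_gpiece`, `eta_inv_eq`, `spacing_mul_eta`) and `B3Bound316ZeroTorus.bracket315_zero_torus`
(*"we can estimate (3.16) by a constant"*, every kernel hypothesis discharged).

WHAT IS PROVED, and how.
* §1 RESCALING (any `d ≥ 2`, any volume, `k ≥ 1`): with `ξ = L^{−k}` (`Params.eta k`), `s = L^kε` (`Params.spacing k`), `ε = sξ`: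
  the resummed η-lattice kernel `G^η_k(0) := Σ_{j<k}G^η_{(j)}` (`Σ_{j<k} gpiece j`, = `ε^{−d}G_k(T_ε,0)` by (2.6), `sum_gpiece_eq_G`)
  and p39's rescaled kernel satisfy `G0xi = s^{d−2}·G^η_k(0)` (`G0xi_eq_rescaled`), `(∂^ξ_νG0xi∂^{ξ*}_ν) = s^d·(∂^η_νG^η_k(0)∂^{η*}_ν)`
  (`dKernel_rescale`), `c^ξ = s^{2d−2}c^η` for the coefficient of (3.9) (`coeff39_rescale`), `(y′_μ − y_μ)_ξ = s^{−1}(x′_μ − x_μ)_η`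
  (`disp_rescale`), hence **`bracket315_rescale`**: `s³·[bracket (3.15) on the ξ-lattice] = s^d·[bracket (3.15) on the η-lattice]`, and
  in `d = 3` the two brackets are EQUAL (`bracket315_rescale_three`) — the printed *"we get the same expression but with L^{−j″} instead
  of η"*.
* §2 THE VERTEX (3.15) ON THE η-LATTICE (d = 3): `abs_bracket315_eta_le` — p39's constant bounds the η-lattice bracket built on the
  actual `G^η_{j″}(0) = G^η_{j″}` of the tower; **`abs_expr315_eta_le`** — `|(3.15)| ≤ Cst·Σ_μΣ_x η³‖φ(x)‖‖q²D_μ(x)‖` for any leg data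
  `D_μ` (in (3.11): `D_μ = ∂^η_μφ′`): the vertex of (3.17) has a bounded coefficient, uniformly in the volume and in `1 ≤ j″ ≤ K`.
* §3 **(3.17)**: `sum_expr39_eq` — for every `η ≠ 0` and every kernel families, `Σ_{j,j′<k}(3.9)[G_{(j)}(0),G_{(j′)}] =
  (3.15)[Σ_jG_{(j)}(0), Σ_{j′}G_{(j′)}] − Σ_{j,j′<k}(3.12)[j,j′]` ((3.11) per pair, `eq311_split`, and the multilinearity `expr315_sum_sum`);
  **`eq317_zero_torus`** — at the zero-field torus instance, `d = 3`: there are `δ, C, Cst > 0` (functions of `L, a, m²`) such that for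
  EVERY volume `P = (3, L, m, K)`, every `1 ≤ k ≤ K` (`k = j″`), all charge matrices `q` (`‖qw‖ ≤ Q‖w‖`), localizations `|g|,|g′| ≤ 1`,
  fields `φ` and Hölder-α legs `φ′`: (a) the identity above with `G_{(j)}(0) = G_{(j′)} = gpiece`, (b) the vertex bound of §2 for the
  resummed term, (c) the generalized-graph estimate (3.13) for every piece `(j, j′)` (`abs_term312_le_zeroTorus`) — i.e. the summed
  expression of (3.8) IS "Σ generalized expressions of degree −d+3+α" + "a vertex with a bounded function", the required form (3.5)
  for this graph; `eq317_zero_torus_cubes` — the same with (c) in the DISPLAYED cube-localized form of (3.13)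
  (`abs_term312_le_cubes_zeroTorus`).
HONEST SCOPE: `d = 3` for §2–§3 (the dimension in which p. 437 estimates (3.16) by a constant; §1 and `sum_expr39_eq` are general);
`A = B̃ = 0`, `U ≡ 1`, `Ω` = the whole torus (scope of `B4Thm110ZeroTorus`/`B3Ineq210ZeroTorus`); at zero field `G_{(j)}(0) = G_{(j)}`
so both lines of (3.8) are pieces of the SAME tower; fixed `a > 0`, `m² ≥ 0`; constants existential; the summation *"with respect to
j, j′ from 0 to j″"* is taken literally over `[0,j″)²` (the admissibility bookkeeping of orderings, row B3.Eq2.7, is not re-derived, as in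
`B3Resummation315`); the leg to which (3.10) is applied is the slot `φ′` (the print's choice *"the leg with a smaller j-index"* concerns
which external leg is named `φ′`).  NOT claimed: `Ω ⊊ T_η`, `B̃ ≠ 0` (rows B3.Eq2.10–2.12 at the print's generality), `d = 2`, the
picture (3.17) as a graph object, Proposition 2.2 for the generalized graphs.  Mathlib + the cited tree files only; theorems only, no
new definitions, no named facts; standard axioms.  Unit `lit-balaban-p20-g6` (Phase-2 proof seat p20, gen 6), HOME
`run/shared/lean/pub/lit-balaban/`, 2026-08-21.
-/

open scoped BigOperators RealInnerProductSpace

namespace Literature.MathematicalPhysics.QuantumFieldTheory.Balaban1983to89.B3Eq317ZeroTorus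

open Finset B1RG242Torus B3Ineq210ZeroTorus B3Sect3KernelsZeroTorus B3GkZeroTorusRescaled B3Bound316ZeroTorus
open LatticeFieldCalculus B3Sect3ScalarSelfEnergy B3Taylor310Remainder B3Ineq313Pointwise B3Resummation315
open B3Sect3EstimatesZeroTorus B3Ineq314Cubes

noncomputable section

universe u

variable {P : Params}

/-! ## §1 Rescaling from the η-lattice to the `L^{−j″}`-lattice (p. 437) -/

section Rescaling

/-- The resummed η-lattice kernel `G^η_k(0) = Σ_{j<k}G^η_{(j)}` (the sum of the Sect.-3 kernels `gpiece`) evaluated at a pair of sites.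
[cite: Balaban1983Higgs3, (2.6) p.424, (3.15) p.437] -/
theorem sum_gpiece_apply (a msq : ℝ) (k : ℕ) (y y' : Site P 0) :
    (∑ i ∈ range k, gpiece P a msq k i) y y' = ∑ i ∈ range k, gpiece P a msq k i y y' := by
  rw [Finset.sum_apply, Finset.sum_apply]

/-- **(2.6) for the resummed kernel of (3.15)**: `Σ_{j<k}G^η_{(j)} = η^{−d}G_k(T_ε,0)` — the `η^d`-normalised zero-field torus propagator
(p03's `sum_pieceT`). [cite: Balaban1983Higgs3, (2.6) p.424, (3.15) p.437] -/
theorem sum_gpiece_eq_G {a msq : ℝ} (ha : 0 < a) (hm : 0 ≤ msq) {k : ℕ} (hk : 1 ≤ k) (y y' : Site P 0) :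
    (∑ i ∈ range k, gpiece P a msq k i) y y' = (P.eps ^ P.d)⁻¹ * (tower P a msq).G k y y' := by
  rw [sum_gpiece_apply]
  unfold gpiece
  rw [← Finset.mul_sum, ← sum_pieceT ha hm hk, Matrix.sum_apply]

/-- p. 437 rescaling, the propagator: `G^ξ_k(0) = (L^kε)^{d−2}·G^η_k(0)` (p39's `G0xi_eq_sum_gpiece` read on the summed kernel).
[cite: Balaban1983Higgs3, (3.16) p.437] -/
theorem G0xi_eq_rescaled {a msq : ℝ} (ha : 0 < a) (hm : 0 ≤ msq) (hd : 2 ≤ P.d) {k : ℕ} (hk : 1 ≤ k) (y y' : Site P 0) :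
    G0xi P a msq k y y' = P.spacing k ^ (P.d - 2) * (∑ i ∈ range k, gpiece P a msq k i) y y' := by
  rw [sum_gpiece_apply, G0xi_eq_sum_gpiece ha hm hd hk]

/-- p. 437 rescaling, the kernel of (3.9): `(∂^ξ_νG^ξ_k(0)∂^{ξ*}_ν)(y,y′) = (L^kε)^d·(∂^η_νG^η_k(0)∂^{η*}_ν)(x,x′)` (`∂^ξ = (L^kε)∂^η`).
[cite: Balaban1983Higgs3, (3.16) p.437] -/
theorem dKernel_rescale {a msq : ℝ} (ha : 0 < a) (hm : 0 ≤ msq) (hd : 2 ≤ P.d) {k : ℕ} (hk : 1 ≤ k) (ν : Fin P.d)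
    (y y' : Site P 0) :
    dKernel (P.eta k)⁻¹ ν (G0xi P a msq k) y y' =
      P.spacing k ^ P.d * dKernel P.eps⁻¹ ν (∑ i ∈ range k, gpiece P a msq k i) y y' := by
  simp only [dKernel, G0xi_eq_rescaled ha hm hd hk, eta_inv_eq]
  have hsplit : P.spacing k ^ P.d = P.spacing k ^ 2 * P.spacing k ^ (P.d - 2) := by
    rw [← pow_add]; congr 1; omega
  rw [hsplit]
  ring

/-- p. 437 rescaling, the coefficient of (3.9)/(3.15): `c^ξ(y,y′) = (L^kε)^{2d−2}·c^η(x,x′)`. [cite: Balaban1983Higgs3, (3.16) p.437] -/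
theorem coeff39_rescale {a msq : ℝ} (ha : 0 < a) (hm : 0 ≤ msq) (hd : 2 ≤ P.d) {k : ℕ} (hk : 1 ≤ k)
    (g g' : SiteField P 0 ℝ) (y y' : Site P 0) :
    coeff39 (P.eta k) (G0xi P a msq k) (G0xi P a msq k) g g' y y' =
      P.spacing k ^ (2 * P.d - 2) *
        coeff39 P.eps (∑ i ∈ range k, gpiece P a msq k i) (∑ i ∈ range k, gpiece P a msq k i) g g' y y' := by
  unfold coeff39
  simp only [dKernel_rescale ha hm hd hk, G0xi_eq_rescaled ha hm hd hk, ← Finset.mul_sum]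
  have hsplit : P.spacing k ^ (2 * P.d - 2) = P.spacing k ^ P.d * P.spacing k ^ (P.d - 2) := by
    rw [← pow_add]; congr 1; omega
  rw [hsplit]
  ring

/-- p. 437 rescaling, the displacement: `(y′_μ − y_μ) = (L^kε)^{−1}(x′_μ − x_μ)` (`x = L^kη·y`). [cite: Balaban1983Higgs3, (3.16) p.437] -/
theorem disp_rescale (k : ℕ) (y y' : Site P 0) (μ : Fin P.d) :
    disp (P.eta k)⁻¹ y y' μ = (P.spacing k)⁻¹ * disp P.eps⁻¹ y y' μ := by
  rw [disp_inv, disp_inv, ← spacing_mul_eta P k]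
  have hs : P.spacing k ≠ 0 := (P.spacing_pos k).ne'
  field_simp

/-- **p. 437, the rescaling sentence for the square bracket of (3.15)** — *"Rescaling it from the η-lattice to the L^{−j″}-lattice
(x, x′ = L^{j″}ηy, L^{j″}ηy′, y, y′ ∈ T_{L^{−j″}}) we get the same expression but with L^{−j″} instead of η"* — PROVED in every dimension
`d ≥ 2` as the scaling law `(L^kε)³·[bracket on the ξ-lattice, G^ξ_k(0)] = (L^kε)^d·[bracket on the η-lattice, G^η_k(0)]` (`ξ^d = (L^kε)^{−d}η^d`,
`c^ξ = (L^kε)^{2d−2}c^η`, displacement `(L^kε)^{−1}`). [cite: Balaban1983Higgs3, (3.15)–(3.16) p.437] -/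
theorem bracket315_rescale {a msq : ℝ} (ha : 0 < a) (hm : 0 ≤ msq) (hd : 2 ≤ P.d) {k : ℕ} (hk : 1 ≤ k)
    (g g' : SiteField P 0 ℝ) (μ : Fin P.d) (y : Site P 0) :
    P.spacing k ^ 3 *
        bracket315 (P.eta k) (G0xi P a msq k) (G0xi P a msq k) g g' (fun μ y y' => disp (P.eta k)⁻¹ y y' μ) μ y =
      P.spacing k ^ P.d *
        bracket315 P.eps (∑ i ∈ range k, gpiece P a msq k i) (∑ i ∈ range k, gpiece P a msq k i) g g'
          (fun μ y y' => disp P.eps⁻¹ y y' μ) μ y := by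
  unfold bracket315
  simp only [coeff39_rescale ha hm hd hk, disp_rescale, Finset.mul_sum]
  refine Finset.sum_congr rfl fun y' _ => ?_
  have hs : P.spacing k ≠ 0 := (P.spacing_pos k).ne'
  have hξ : P.eta k = P.eps * (P.spacing k)⁻¹ := by
    rw [← spacing_mul_eta P k]; field_simp
  rw [hξ, mul_pow]
  have h3 : P.spacing k ^ (2 * P.d - 2) = P.spacing k ^ P.d * P.spacing k ^ (P.d - 2) := by
    rw [← pow_add]; congr 1; omega
  have h1 : (P.spacing k)⁻¹ ^ P.d * P.spacing k ^ (2 * P.d - 2) = P.spacing k ^ (P.d - 2) := by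
    rw [h3, ← mul_assoc, ← mul_pow, inv_mul_cancel₀ hs, one_pow, one_mul]
  have h2 : P.spacing k ^ 3 * (P.spacing k)⁻¹ * P.spacing k ^ (P.d - 2) = P.spacing k ^ P.d := by
    have h32 : P.spacing k ^ 3 * (P.spacing k)⁻¹ = P.spacing k ^ 2 := by field_simp
    rw [h32, ← pow_add]; congr 1; omega
  set c := coeff39 P.eps (∑ i ∈ range k, gpiece P a msq k i) (∑ i ∈ range k, gpiece P a msq k i) g g' y y'
  set D := disp P.eps⁻¹ y y' μ
  have eq1 : P.spacing k ^ 3 * (P.eps ^ P.d * (P.spacing k)⁻¹ ^ P.d *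
      (P.spacing k ^ (2 * P.d - 2) * c * ((P.spacing k)⁻¹ * D))) =
      P.spacing k ^ 3 * (P.spacing k)⁻¹ * ((P.spacing k)⁻¹ ^ P.d * P.spacing k ^ (2 * P.d - 2)) *
        (P.eps ^ P.d * (c * D)) := by ring
  rw [eq1, h1, h2]

/-- **p. 437, d = 3: "the same expression but with L^{−j″} instead of η"** — in three dimensions the square bracket of (3.15) is
scale-invariant: the ξ-lattice bracket on `G^ξ_{j″}(0)` EQUALS the η-lattice bracket on `G^η_{j″}(0)`. [cite: Balaban1983Higgs3, (3.15)–(3.16) p.437] -/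
theorem bracket315_rescale_three {a msq : ℝ} (ha : 0 < a) (hm : 0 ≤ msq) (hd : P.d = 3) {k : ℕ} (hk : 1 ≤ k)
    (g g' : SiteField P 0 ℝ) (μ : Fin P.d) (y : Site P 0) :
    bracket315 (P.eta k) (G0xi P a msq k) (G0xi P a msq k) g g' (fun μ y y' => disp (P.eta k)⁻¹ y y' μ) μ y =
      bracket315 P.eps (∑ i ∈ range k, gpiece P a msq k i) (∑ i ∈ range k, gpiece P a msq k i) g g'
        (fun μ y y' => disp P.eps⁻¹ y y' μ) μ y := by
  have h := bracket315_rescale ha hm (by omega) hk g g' μ y (a := a) (msq := msq)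
  have h3 : P.spacing k ^ P.d = P.spacing k ^ 3 := by rw [hd]
  rw [h3] at h
  exact mul_left_cancel₀ (pow_ne_zero 3 (P.spacing_pos k).ne') h

end Rescaling

/-! ## §2 The vertex (3.15) on the η-lattice: a bounded coefficient (d = 3) -/

section Vertex

/-- **p. 437 "Let us estimate the coefficient in the vertex, i.e. the expression in the square brackets in (3.15)" — ON THE η-LATTICE**:
for odd `L > 1`, `a > 0`, `m² ≥ 0` there is `Cst > 0` such that for every volume `P = (3, L, m, K)`, every `1 ≤ k ≤ K`, all
`|g|, |g′| ≤ 1`, `μ`, `x`: `|[bracket (3.15)](G^η_k(0), G^η_k)(x)| ≤ Cst` (p39's `bracket315_zero_torus` transported by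
`bracket315_rescale_three`). [cite: Balaban1983Higgs3, (3.15)–(3.16) p.437] -/
theorem abs_bracket315_eta_le (L : ℕ) (hL : Odd L ∧ 1 < L) {a : ℝ} (ha : 0 < a) {msq : ℝ} (hmsq : 0 ≤ msq) :
    ∃ Cst : ℝ, 0 < Cst ∧ ∀ (P : Params), P.d = 3 → P.L = L → ∀ k : ℕ, 1 ≤ k → k ≤ P.K →
      ∀ (g g' : SiteField P 0 ℝ) (μ : Fin P.d), (∀ y, |g y| ≤ 1) → (∀ y, |g' y| ≤ 1) → ∀ x : Site P 0,
        |bracket315 P.eps (∑ i ∈ range k, gpiece P a msq k i) (∑ i ∈ range k, gpiece P a msq k i) g g'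
            (fun μ y y' => disp P.eps⁻¹ y y' μ) μ x| ≤ Cst := by
  obtain ⟨Cst, hCst, H⟩ := bracket315_zero_torus L hL ha hmsq
  refine ⟨Cst, hCst, fun P hPd hPL k hk1 hkK g g' μ hg hg' x => ?_⟩
  rw [← bracket315_rescale_three ha hmsq hPd hk1 g g' μ x]
  exact H P hPd hPL k hk1 hkK g g' μ hg hg' x

/-- kernel: `|⟪a, b⟫| ≤ ‖a‖‖b‖`. [folklore] -/
private theorem abs_inner_le' {W : Type u} [NormedAddCommGroup W] [InnerProductSpace ℝ W] (a b : W) :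
    |⟪a, b⟫| ≤ ‖a‖ * ‖b‖ :=
  abs_real_inner_le_norm a b

/-- **(3.15)/(3.17), the vertex has a BOUNDED coefficient, on the η-lattice** (d = 3): with the constant of `abs_bracket315_eta_le`, for every
volume, every `1 ≤ k ≤ K`, all `q`, `|g|,|g′| ≤ 1`, `φ` and leg data `D` (in (3.11)/(3.15): `D_μ = ∂^η_μφ′`):
`|(3.15)[G^η_k(0), G^η_k]| ≤ Cst·Σ_μΣ_x η^d‖φ(x)‖‖q²D_μ(x)‖` — a vertex of the type (3.22) with a bounded function. [cite: Balaban1983Higgs3, (3.15)–(3.17) p.437] -/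
theorem abs_expr315_eta_le (L : ℕ) (hL : Odd L ∧ 1 < L) {a : ℝ} (ha : 0 < a) {msq : ℝ} (hmsq : 0 ≤ msq) :
    ∃ Cst : ℝ, 0 < Cst ∧ ∀ (P : Params), P.d = 3 → P.L = L → ∀ k : ℕ, 1 ≤ k → k ≤ P.K →
      ∀ {W : Type u} [NormedAddCommGroup W] [InnerProductSpace ℝ W] (q : W →ₗ[ℝ] W) (g g' : SiteField P 0 ℝ)
        (φ : SiteField P 0 W) (D : Fin P.d → SiteField P 0 W), (∀ y, |g y| ≤ 1) → (∀ y, |g' y| ≤ 1) →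
        |expr315 P.eps q (∑ i ∈ range k, gpiece P a msq k i) (∑ i ∈ range k, gpiece P a msq k i) g g'
            (fun μ y y' => disp P.eps⁻¹ y y' μ) φ D| ≤
          Cst * ∑ μ : Fin P.d, ∑ x : Site P 0, P.eps ^ P.d * (‖φ x‖ * ‖q (q (D μ x))‖) := by
  obtain ⟨Cst, hCst, H⟩ := abs_bracket315_eta_le L hL ha hmsq
  refine ⟨Cst, hCst, fun P hPd hPL k hk1 hkK W _ _ q g g' φ D hg hg' => ?_⟩
  have hε : 0 < P.eps := P.eps_pos
  unfold expr315
  rw [abs_neg, Finset.mul_sum]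
  refine (Finset.abs_sum_le_sum_abs _ _).trans (Finset.sum_le_sum fun μ _ => ?_)
  rw [Finset.mul_sum]
  refine (Finset.abs_sum_le_sum_abs _ _).trans (Finset.sum_le_sum fun x _ => ?_)
  rw [abs_mul, abs_of_nonneg (by positivity : (0 : ℝ) ≤ P.eps ^ P.d), abs_mul]
  have hb := H P hPd hPL k hk1 hkK g g' μ hg hg' x
  have hi := abs_inner_le' (φ x) (q (q (D μ x)))
  have h0 : 0 ≤ ‖φ x‖ * ‖q (q (D μ x))‖ := by positivity
  calc P.eps ^ P.d * (|bracket315 P.eps (∑ i ∈ range k, gpiece P a msq k i) (∑ i ∈ range k, gpiece P a msq k i) g g'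
            (fun μ y y' => disp P.eps⁻¹ y y' μ) μ x| * |⟪φ x, q (q (D μ x))⟫|)
      ≤ P.eps ^ P.d * (Cst * (‖φ x‖ * ‖q (q (D μ x))‖)) :=
        mul_le_mul_of_nonneg_left (mul_le_mul hb hi (abs_nonneg _) hCst.le) (by positivity)
    _ = Cst * (P.eps ^ P.d * (‖φ x‖ * ‖q (q (D μ x))‖)) := by ring

end Vertex

/-! ## §3 (3.17): the analysis of (3.8) assembled -/

section Eq317

variable {j : ℕ} {W : Type u} [NormedAddCommGroup W] [InnerProductSpace ℝ W]

/-- **(3.17), the identity** (any `η ≠ 0`, any kernel families): the expressions (3.9) of the graph (3.8) with lines `G_{(i)}(0)`, `G_{(i′)}`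
summed over `i, i′ < k` EQUAL the vertex (3.15) built on the resummed propagators `Σ_iG_{(i)}(0)`, `Σ_{i′}G_{(i′)}` minus the sum of the
generalized expressions (3.12): (3.11) for each pair (`eq311_split`, the first term being `expr315` by `expr315_eq`) and the
multilinearity of (3.15) in its two propagator slots (`expr315_sum_sum` — *"Making summations over these orderings and indices"*).
[cite: Balaban1983Higgs3, (3.11) p.436, (3.15)/(3.17) p.437] -/
theorem sum_expr39_eq (η : ℝ) (hη : η ≠ 0) (q : W →ₗ[ℝ] W) (k : ℕ) (G0fam Gfam : ℕ → Kernel P j)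
    (g g' : SiteField P j ℝ) (φ φ' : SiteField P j W) :
    ∑ i ∈ range k, ∑ i' ∈ range k, expr39 η q (G0fam i) (Gfam i') g g' φ φ' =
      expr315 η q (∑ i ∈ range k, G0fam i) (∑ i' ∈ range k, Gfam i') g g' (fun μ x x' => disp η⁻¹ x x' μ) φ
          (fun μ => pdiff η⁻¹ μ φ') -
        ∑ i ∈ range k, ∑ i' ∈ range k, term312 η q (G0fam i) (Gfam i') g g' φ φ' := by
  rw [← expr315_sum_sum, ← Finset.sum_sub_distrib]
  refine Finset.sum_congr rfl fun i _ => ?_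
  rw [← Finset.sum_sub_distrib]
  refine Finset.sum_congr rfl fun i' _ => ?_
  rw [eq311_split η hη q (G0fam i) (Gfam i') g g' φ φ', expr315_eq]

/-- **(3.17) p. 437 AT THE ZERO-FIELD TORUS MODEL INSTANCE, d = 3** — *"Thus we have finished the analysis of (3.8) and we can summarize
it in the following graphical form (3.17). It is of the required form (3.5)."*: for odd `L > 1`, `a > 0`, `m² ≥ 0` there are `δ, C, Cst > 0`
(functions of `L, a, m²`) such that for EVERY volume `P = (3, L, m, K)` of Bałaban's scalar torus tower, every `1 ≤ k ≤ K` (`k = j″`, the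
lowest index of the external lines), every charge matrix `q` with `‖qw‖ ≤ Q‖w‖`, localizations `|g|, |g′| ≤ 1`, every field `φ` and every
Hölder-α leg `φ′` (`0 ≤ α ≤ 1`):
(a) `Σ_{j,j′<k}(3.9)[G^η_{(j)}(0), G^η_{(j′)}] = (3.15)[G^η_k(0), G^η_k] − Σ_{j,j′<k}(3.12)[j,j′]` (lines = the tower's pieces `gpiece`);
(b) the vertex (3.15) has a bounded coefficient: `|(3.15)| ≤ Cst·Σ_μΣ_x η³‖φ(x)‖‖q²(∂^η_μφ′)(x)‖`;
(c) every piece (3.12) obeys the generalized-graph estimate (3.13) with the factors `(L^jη)^{−d}e^{−½δ|x−x′|/L^jη}(L^{j′}η)^{−d+2}e^{…}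
(L^{j₁}η)^{1+α}`, `j₁ = min(j,j′)` (degree `−d + 3 + α`). [cite: Balaban1983Higgs3, (3.17) p.437] -/
theorem eq317_zero_torus (L : ℕ) (hL : Odd L ∧ 1 < L) {a : ℝ} (ha : 0 < a) {msq : ℝ} (hmsq : 0 ≤ msq) :
    ∃ δ C Cst : ℝ, 0 < δ ∧ 0 < C ∧ 0 < Cst ∧ ∀ (P : Params), P.d = 3 → P.L = L → ∀ k : ℕ, 1 ≤ k → k ≤ P.K →
      ∀ {W : Type u} [NormedAddCommGroup W] [InnerProductSpace ℝ W] {α H Q : ℝ}, 0 ≤ α → α ≤ 1 → 0 ≤ H → 0 ≤ Q →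
        ∀ (q : W →ₗ[ℝ] W), (∀ w : W, ‖q w‖ ≤ Q * ‖w‖) →
        ∀ (g g' : SiteField P 0 ℝ), (∀ x, |g x| ≤ 1) → (∀ x, |g' x| ≤ 1) →
        ∀ (φ φ' : SiteField P 0 W), HolderDeriv (P.eps)⁻¹ α H φ' →
          (∑ i ∈ range k, ∑ i' ∈ range k, expr39 P.eps q (gpiece P a msq k i) (gpiece P a msq k i') g g' φ φ' =
              expr315 P.eps q (∑ i ∈ range k, gpiece P a msq k i) (∑ i ∈ range k, gpiece P a msq k i) g g'
                  (fun μ x x' => disp P.eps⁻¹ x x' μ) φ (fun μ => pdiff P.eps⁻¹ μ φ') -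
                ∑ i ∈ range k, ∑ i' ∈ range k, term312 P.eps q (gpiece P a msq k i) (gpiece P a msq k i') g g' φ φ') ∧
          |expr315 P.eps q (∑ i ∈ range k, gpiece P a msq k i) (∑ i ∈ range k, gpiece P a msq k i) g g'
              (fun μ x x' => disp P.eps⁻¹ x x' μ) φ (fun μ => pdiff P.eps⁻¹ μ φ')| ≤
            Cst * ∑ μ : Fin P.d, ∑ x : Site P 0, P.eps ^ P.d * (‖φ x‖ * ‖q (q (pdiff P.eps⁻¹ μ φ' x))‖) ∧
          ∀ i i' : ℕ,
            |term312 P.eps q (gpiece P a msq k i) (gpiece P a msq k i') g g' φ φ'| ≤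
              2 * P.d * C * C * Q ^ 2 * H * (2 / δ + 8 / δ ^ 2) *
                (min (P.spacing i) (P.spacing i') * (min (P.spacing i) (P.spacing i')) ^ α) *
                ∑ x : Site P 0, ∑ x' : Site P 0, P.eps ^ (2 * P.d) *
                  (‖φ x‖ * (P.spacing i ^ (-(P.d : ℝ)) *
                      Real.exp (-(δ / 2 * (P.spacing i)⁻¹ * (P.eps * Site.tdist x x'))))
                    * (P.spacing i' ^ ((2 : ℝ) - (P.d : ℝ)) *
                      Real.exp (-(δ / 2 * (P.spacing i')⁻¹ * (P.eps * Site.tdist x x'))))) := by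
  obtain ⟨δ, C, hδ, hC, H13⟩ := abs_term312_le_zeroTorus.{u} 3 L (by norm_num) hL ha hmsq
  obtain ⟨Cst, hCst, H15⟩ := abs_expr315_eta_le.{u} L hL ha hmsq
  refine ⟨δ, C, Cst, hδ, hC, hCst, ?_⟩
  intro P hPd hPL k hk1 hkK W _ _ α H Q hα0 hα1 hH hQ q hq g g' hg hg' φ φ' hφ'
  refine ⟨sum_expr39_eq P.eps P.eps_pos.ne' q k _ _ g g' φ φ', H15 P hPd hPL k hk1 hkK q g g' φ _ hg hg', fun i i' => ?_⟩
  exact H13 P hPd hPL k hk1 hkK i i' hα0 hα1 hH hQ q hq g g' hg hg' φ φ' hφ'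

/-- **(3.17) with the estimate (3.13) in its DISPLAYED cube-localized form** (p. 436 *"We localize additionally the vertices in cubes
Δ(v), Δ(v′)"*; p20 g5's `abs_term312_le_cubes_zeroTorus`, cubes of side `M` lattice units): the identity (a) and the vertex bound (b) of
`eq317_zero_torus` together with (c′) `|(3.12)[j,j′]| ≤ 2dC²Q²H(2/δ+8/δ²)(m·m^α)Σ_{Δ,Δ′}(Mη)^{2d}sup_{x∈Δ}‖φ(x)‖(L^jη)^{−d}
e^{−½δ·dist(Δ,Δ′)/L^jη}(L^{j′}η)^{−d+2}e^{−½δ·dist(Δ,Δ′)/L^{j′}η}`. [cite: Balaban1983Higgs3, (3.13) p.436, (3.17) p.437] -/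
theorem eq317_zero_torus_cubes (L : ℕ) (hL : Odd L ∧ 1 < L) {a : ℝ} (ha : 0 < a) {msq : ℝ} (hmsq : 0 ≤ msq) :
    ∃ δ C Cst : ℝ, 0 < δ ∧ 0 < C ∧ 0 < Cst ∧ ∀ (P : Params), P.d = 3 → P.L = L → ∀ k : ℕ, 1 ≤ k → k ≤ P.K →
      ∀ {W : Type u} [NormedAddCommGroup W] [InnerProductSpace ℝ W] {α H Q : ℝ}, 0 ≤ α → α ≤ 1 → 0 ≤ H → 0 ≤ Q →
        ∀ (q : W →ₗ[ℝ] W), (∀ w : W, ‖q w‖ ≤ Q * ‖w‖) →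
        ∀ (g g' : SiteField P 0 ℝ), (∀ x, |g x| ≤ 1) → (∀ x, |g' x| ≤ 1) →
        ∀ (φ φ' : SiteField P 0 W), HolderDeriv (P.eps)⁻¹ α H φ' →
          (∑ i ∈ range k, ∑ i' ∈ range k, expr39 P.eps q (gpiece P a msq k i) (gpiece P a msq k i') g g' φ φ' =
              expr315 P.eps q (∑ i ∈ range k, gpiece P a msq k i) (∑ i ∈ range k, gpiece P a msq k i) g g'
                  (fun μ x x' => disp P.eps⁻¹ x x' μ) φ (fun μ => pdiff P.eps⁻¹ μ φ') -
                ∑ i ∈ range k, ∑ i' ∈ range k, term312 P.eps q (gpiece P a msq k i) (gpiece P a msq k i') g g' φ φ') ∧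
          |expr315 P.eps q (∑ i ∈ range k, gpiece P a msq k i) (∑ i ∈ range k, gpiece P a msq k i) g g'
              (fun μ x x' => disp P.eps⁻¹ x x' μ) φ (fun μ => pdiff P.eps⁻¹ μ φ')| ≤
            Cst * ∑ μ : Fin P.d, ∑ x : Site P 0, P.eps ^ P.d * (‖φ x‖ * ‖q (q (pdiff P.eps⁻¹ μ φ' x))‖) ∧
          ∀ (i i' : ℕ) {M : ℕ}, 0 < M →
            |term312 P.eps q (gpiece P a msq k i) (gpiece P a msq k i') g g' φ φ'| ≤
              2 * P.d * C * C * Q ^ 2 * H * (2 / δ + 8 / δ ^ 2) *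
                (min (P.spacing i) (P.spacing i') * (min (P.spacing i) (P.spacing i')) ^ α) *
                ∑ c ∈ cubes P 0 M, ∑ c' ∈ cubes P 0 M, ((M : ℝ) * P.eps) ^ (2 * P.d) *
                  (supOn (fiber M c : Finset (Site P 0)) (fun x => ‖φ x‖) *
                    ((P.spacing i ^ (-(P.d : ℝ)) *
                        Real.exp (-(δ / 2 * (P.spacing i)⁻¹ * (P.eps * (cdist P 0 M M c c' : ℝ))))) *
                      (P.spacing i' ^ ((2 : ℝ) - (P.d : ℝ)) *
                        Real.exp (-(δ / 2 * (P.spacing i')⁻¹ * (P.eps * (cdist P 0 M M c c' : ℝ))))))) := by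
  obtain ⟨δ, C, hδ, hC, H13⟩ := abs_term312_le_cubes_zeroTorus.{u} 3 L (by norm_num) hL ha hmsq
  obtain ⟨Cst, hCst, H15⟩ := abs_expr315_eta_le.{u} L hL ha hmsq
  refine ⟨δ, C, Cst, hδ, hC, hCst, ?_⟩
  intro P hPd hPL k hk1 hkK W _ _ α H Q hα0 hα1 hH hQ q hq g g' hg hg' φ φ' hφ'
  refine ⟨sum_expr39_eq P.eps P.eps_pos.ne' q k _ _ g g' φ φ', H15 P hPd hPL k hk1 hkK q g g' φ _ hg hg', fun i i' M hM => ?_⟩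
  exact H13 δ hδ le_rfl P hPd hPL k hk1 hkK i i' hα0 hα1 hH hQ q hq g g' hg hg' φ φ' hφ' hM

end Eq317

end

end Literature.MathematicalPhysics.QuantumFieldTheory.Balaban1983to89.B3Eq317ZeroTorus
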